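import Literature.NumberTheory.GaloisRepresentations.HasseArfCyclicNormProofs
import HarnessLib

/-!
# The cyclic totally ramified case of Hasse–Arf, II: the twisted units `s(u)/u` and Serre's Lemmas V.8, V.11, V.12

Continuation of `HasseArfCyclicNormProofs.lean` (abstract setting: a DVR `S` with an action of a
finite group `G`, `s ∈ G`).  Writing "`x ∈ W`" for `∃ u unit, x u = s(u)`:

* `W` is closed under products and inverses, consists of units, and of norm-one elements
  (`twist_mul`, `twist_units_inv`, `isUnit_of_twist`, `prod_smul_eq_one_of_twist`);
* **Lemma V.11** (`exists_twist_sub_mem_pow_succ`): if every residue class contains an `s`-fixed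
  element (residue degree one) and some `x₁ ∈ W` lies in `1 + 𝔪ᵐ ∖ 1 + 𝔪ᵐ⁺¹`, then every
  `x ≡ 1 mod 𝔪ᵐ` is congruent mod `𝔪ᵐ⁺¹` to an element of `W ∩ (1 + 𝔪ᵐ)` (Serre's
  `y_a = 1 + a z`, `x_a - 1 = a (y/y_a)(x₁ - 1)`);
* **Lemma V.8 from Hilbert 90 in ring form** (`exists_twist_mul_pow`): if every norm-one `x` has
  `s(y) = x y` for some `y ≠ 0`, then `x = w cʲ` with `w ∈ W`, `c = s(ϖ)/ϖ`, `j ∈ ℕ`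
  (`V/W` is a quotient of `L*/U_L = ℤ`);
* **Lemma V.12, non-triviality of `H_m`** (`exists_twist_not_mem_pow_succ`): if moreover the
  residue field is not additively cyclic (not the prime field) and the image of `V_m` in
  `U^m/U^{m+1}` is everything, then `W ∩ (1 + 𝔪ᵐ) ⊄ 1 + 𝔪ᵐ⁺¹`: otherwise `U^m/U^{m+1} ≅ K̄`
  would be a quotient of the cyclic group `V_m/W_m ↪ V/W = ⟨c̄⟩` (carried out with the quotient
  `Sˣ/𝒲` and Mathlib's `IsCyclic` API).

## References

* J.-P. Serre, *Local Fields*, GTM 67, Springer 1979, Ch. V §7, Lemmas 8, 11, 12 (pp. 94–95).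
  [SerreLocalFields1979]
-/

noncomputable section

open IsLocalRing IsDiscreteValuationRing
open scoped Pointwise

namespace Literature.NumberTheory.GaloisRepresentations

namespace HasseArfCyclic

/-! ### Serre's Lemma V.11 -/

section Lemma11

variable {S : Type*} [CommRing S] [IsDomain S] [IsDiscreteValuationRing S]
variable {G : Type*} [Group G] [MulSemiringAction G S]

/-- **Serre's Lemma V.11** (ring form).  Suppose every residue class of `S` contains an `s`-fixed
element (residue degree one).  If some `x₁ = s(u)/u` (`u` a unit) lies in `1 + 𝔪ᵐ` but not in
`1 + 𝔪ᵐ⁺¹`, then every class of `(1 + 𝔪ᵐ)/(1 + 𝔪ᵐ⁺¹)` contains such an element: for `x ≡ 1 mod 𝔪ᵐ`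
there is `x' = s(u')/u'`, `x' ≡ 1 mod 𝔪ᵐ`, with `x ≡ x' mod 𝔪ᵐ⁺¹`.  (Serre: `x₁ = y^{s-1}` with
`y ≡ 1`, `y_a = 1 + a z`, `x_a - 1 = a (y/y_a)(x₁ - 1)`.)
Ref: Serre, *Local Fields*, Ch. V §7, Lemma 11 (p. 95). [cite: SerreLocalFields1979, Ch. V §7 Lemma 11] -/
theorem exists_twist_sub_mem_pow_succ (s : G) {m : ℕ}
    (hf1 : ∀ q : S, ∃ a : S, s • a = a ∧ a - q ∈ maximalIdeal S)
    {x₁ : S} (hW₁ : ∃ u : S, IsUnit u ∧ x₁ * u = s • u)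
    (hx₁ : x₁ - 1 ∈ maximalIdeal S ^ m) (hx₁' : x₁ - 1 ∉ maximalIdeal S ^ (m + 1))
    {x : S} (hx : x - 1 ∈ maximalIdeal S ^ m) :
    ∃ x' : S, (∃ u : S, IsUnit u ∧ x' * u = s • u) ∧ x' - 1 ∈ maximalIdeal S ^ m ∧
      x - x' ∈ maximalIdeal S ^ (m + 1) := by
  obtain ⟨u, ⟨U, rfl⟩, hxU⟩ := hW₁
  -- Step A: replace `U` by `y = a₀ U ≡ 1 mod 𝔪`, still with `x₁ y = s y`
  obtain ⟨a₀, ha₀s, ha₀⟩ := hf1 ↑U⁻¹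
  set y : S := a₀ * U with hy
  have hy1 : y - 1 ∈ maximalIdeal S := by
    have : y - 1 = (a₀ - ↑U⁻¹) * U := by
      rw [sub_mul, Units.inv_mul, hy]
    rw [this]
    exact Ideal.mul_mem_right _ _ ha₀
  have hxy : x₁ * y = s • y := by
    rw [hy, mul_left_comm, hxU, smul_mul', ha₀s]
  -- Step B: `x - 1 = (x₁ - 1) q₀` (valuations), and `b` fixed with `b ≡ q₀ mod 𝔪`
  have hdvd : x₁ - 1 ∣ x - 1 := by
    rw [← addVal_le_iff_dvd]
    have h1 : (m : ℕ∞) ≤ addVal S (x - 1) := (mem_maximalIdeal_pow_iff_le_addVal _ _).mp hx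
    have h2 : ¬ ((m + 1 : ℕ) : ℕ∞) ≤ addVal S (x₁ - 1) := fun h =>
      hx₁' ((mem_maximalIdeal_pow_iff_le_addVal _ _).mpr h)
    have h3 : addVal S (x₁ - 1) ≤ m := by
      rw [not_le, Nat.cast_succ, ENat.lt_coe_add_one_iff] at h2
      exact h2
    exact h3.trans h1
  obtain ⟨q₀, hq₀⟩ := hdvd
  obtain ⟨b, hbs, hb⟩ := hf1 q₀
  -- Step C: `y_b = 1 + b (y - 1)` and `x_b = s(y_b)/y_b`
  set yb : S := 1 + b * (y - 1) with hyb
  have hyb1 : yb - 1 ∈ maximalIdeal S := by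
    rw [hyb, add_sub_cancel_left]
    exact Ideal.mul_mem_left _ _ hy1
  have hybu : IsUnit yb := isUnit_of_sub_one_mem (n := 1) le_rfl (by rwa [pow_one])
  obtain ⟨Yb, hYb⟩ := id hybu
  have hinv : (↑Yb⁻¹ : S) * yb = 1 := by rw [← hYb, Units.inv_mul]
  have hsyb : s • yb = 1 + b * (x₁ * y - 1) := by
    rw [hyb, smul_add, smul_one, smul_mul', hbs, smul_sub, smul_one, ← hxy]
  -- the key identity `(x_b - 1) y_b = b (x₁ - 1) y`
  have hdag : (s • yb * ↑Yb⁻¹ - 1) * yb = b * (x₁ - 1) * y := by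
    rw [sub_mul, mul_assoc, hinv, mul_one, one_mul, hsyb, hyb]
    ring
  refine ⟨s • yb * ↑Yb⁻¹, ⟨yb, hybu, ?_⟩, ?_, ?_⟩
  · rw [mul_assoc, hinv, mul_one]
  · rw [← Ideal.mul_unit_mem_iff_mem _ hybu, hdag]
    exact Ideal.mul_mem_right _ _ (Ideal.mul_mem_left _ _ hx₁)
  · rw [← Ideal.mul_unit_mem_iff_mem _ hybu]
    have hexp : (x - s • yb * ↑Yb⁻¹) * yb =
        (x₁ - 1) * (q₀ - b) + (x - 1) * (yb - 1) - b * (x₁ - 1) * (y - 1) := by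
      linear_combination (-1 : S) * hdag + hq₀
    have hqb : q₀ - b ∈ maximalIdeal S := by
      rw [← neg_sub]
      exact (maximalIdeal S).neg_mem hb
    rw [hexp, pow_succ]
    refine Ideal.sub_mem _ (Ideal.add_mem _ ?_ ?_) ?_
    · exact Ideal.mul_mem_mul hx₁ hqb
    · exact Ideal.mul_mem_mul hx hyb1
    · exact Ideal.mul_mem_mul (Ideal.mul_mem_left _ _ hx₁) hy1

end Lemma11

/-! ### The twisted elements `s(u)/u` and Serre's Lemma V.12 -/

section Lemma12

variable {S : Type*} [CommRing S] [IsDomain S] [IsDiscreteValuationRing S]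
variable {G : Type*} [Group G] [Fintype G] [MulSemiringAction G S]

omit [IsDomain S] [IsDiscreteValuationRing S] [Fintype G] in
/-- Products of elements of the form `s(u)/u`, `u` a unit, are of that form. [folklore] -/
theorem twist_mul (s : G) {x x' : S} (hx : ∃ u : S, IsUnit u ∧ x * u = s • u)
    (hx' : ∃ u : S, IsUnit u ∧ x' * u = s • u) :
    ∃ u : S, IsUnit u ∧ x * x' * u = s • u := by
  obtain ⟨u, hu, h⟩ := hx
  obtain ⟨u', hu', h'⟩ := hx'
  exact ⟨u * u', hu.mul hu', by rw [smul_mul', ← h, ← h']; ring⟩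

omit [IsDomain S] [IsDiscreteValuationRing S] [Fintype G] in
/-- An element `x` with `x u = s(u)`, `u` a unit, is a unit. [folklore] -/
theorem isUnit_of_twist (s : G) {x : S} (hx : ∃ u : S, IsUnit u ∧ x * u = s • u) : IsUnit x := by
  obtain ⟨u, hu, h⟩ := hx
  have : IsUnit (x * u) := by
    rw [h]
    exact hu.map (MulSemiringAction.toRingHom G S s)
  exact isUnit_of_mul_isUnit_left this

omit [IsDiscreteValuationRing S] [Fintype G] in
/-- Inverses of units of the form `s(u)/u` are of that form. [folklore] -/
theorem twist_units_inv (s : G) {X : Sˣ} (hX : ∃ u : S, IsUnit u ∧ (X : S) * u = s • u) :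
    ∃ u : S, IsUnit u ∧ (↑X⁻¹ : S) * u = s • u := by
  obtain ⟨u, ⟨U, rfl⟩, h⟩ := hX
  refine ⟨↑U⁻¹, Units.isUnit _, ?_⟩
  have hne : s • (U : S) ≠ 0 := by
    rw [Ne, smul_eq_zero_iff_eq]
    exact U.ne_zero
  have e1 : (↑X⁻¹ : S) * ↑U⁻¹ * s • (U : S) = 1 := by
    rw [← h, show (↑X⁻¹ : S) * ↑U⁻¹ * (↑X * ↑U) = (↑X⁻¹ * ↑X) * (↑U⁻¹ * ↑U) by ring,
      Units.inv_mul, Units.inv_mul, one_mul]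
  have e2 : s • (↑U⁻¹ : S) * s • (U : S) = 1 := by
    rw [← smul_mul', Units.inv_mul, smul_one]
  exact mul_right_cancel₀ hne (e1.trans e2.symm)

omit [IsDiscreteValuationRing S] in
/-- Elements of the form `s(u)/u` have norm one. [folklore] -/
theorem prod_smul_eq_one_of_twist (s : G) {x : S} (hx : ∃ u : S, IsUnit u ∧ x * u = s • u) :
    ∏ g : G, g • x = 1 := by
  obtain ⟨u, hu, hxu⟩ := hx
  have h := prod_smul_mul (G := G) x u
  rw [hxu, prod_smul_smul] at h
  have hu0 : ∏ g : G, g • u ≠ 0 := by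
    rw [Finset.prod_ne_zero_iff]
    intro g _
    rw [Ne, smul_eq_zero_iff_eq]
    exact hu.ne_zero
  exact (mul_eq_right₀ hu0).mp h.symm

/-- **Hilbert 90, ring form ⇒ `V ⊆ W · cᴺ`** (Serre's Lemma V.8: `V/W` is a quotient of
`L*/U_L = ℤ`).  If every norm-one `x` satisfies `s(y) = x y` for some `y ≠ 0` (`y = u ϖʲ`), then
`x = (s(u)/u) · cʲ` with `c = s(ϖ)/ϖ`.
Ref: Serre, *Local Fields*, Ch. V §7, Lemma 8 (p. 94). [cite: SerreLocalFields1979, Ch. V §7 Lemma 8] -/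
theorem exists_twist_mul_pow (s : G) {ϖ : S} (hϖ : Irreducible ϖ) (c : Sˣ) (hc : ϖ * c = s • ϖ)
    (h90 : ∀ x : S, ∏ g : G, g • x = 1 → ∃ y : S, y ≠ 0 ∧ s • y = x * y)
    {x : S} (hx : ∏ g : G, g • x = 1) :
    ∃ w : S, (∃ u : S, IsUnit u ∧ w * u = s • u) ∧ ∃ j : ℕ, x = w * (c : S) ^ j := by
  obtain ⟨y, hy0, hy⟩ := h90 x hx
  obtain ⟨j, u₀, rfl⟩ := eq_unit_mul_pow_irreducible hy0 hϖ
  have key : x * ↑u₀ = s • (u₀ : S) * (c : S) ^ j := by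
    have h1 : s • ((u₀ : S) * ϖ ^ j) = s • (u₀ : S) * (c : S) ^ j * ϖ ^ j := by
      rw [smul_mul', smul_pow', ← hc, mul_pow]
      ring
    rw [h1] at hy
    have hϖj : ϖ ^ j ≠ 0 := pow_ne_zero _ hϖ.ne_zero
    apply mul_right_cancel₀ hϖj
    linear_combination -hy
  refine ⟨s • (u₀ : S) * ↑u₀⁻¹, ⟨u₀, Units.isUnit _, by rw [mul_assoc, Units.inv_mul, mul_one]⟩,
    j, ?_⟩
  calc x = x * ↑u₀ * ↑u₀⁻¹ := by rw [mul_assoc, Units.mul_inv, mul_one]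
    _ = s • (u₀ : S) * ↑u₀⁻¹ * (c : S) ^ j := by rw [key]; ring

/-- **Serre's Lemma V.12, the non-triviality of `H_m`** (ring form).  Assume: Hilbert 90 in ring
form, the residue field is not (additively) cyclic — "not the prime field" —, `m ≥ 1`, and every
principal unit of level `m` is congruent modulo `𝔪ᵐ⁺¹` to a norm-one principal unit of level `m`
(the image of `V_m` in `U^m/U^{m+1}` is everything).  Then some `x₁ = s(u)/u` lies in
`1 + 𝔪ᵐ ∖ 1 + 𝔪ᵐ⁺¹` (the image `H_m` of `W_m` is non-zero): otherwise `U^m/U^{m+1} ≅ K̄` would be a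
quotient of the cyclic group `V_m/W_m ↪ V/W = ⟨c̄⟩`.
Ref: Serre, *Local Fields*, Ch. V §7, Lemmas 8 and 12 (pp. 94–95). [cite: SerreLocalFields1979, Ch. V §7 Lemma 12] -/
theorem exists_twist_not_mem_pow_succ (s : G) {ϖ : S} (hϖ : Irreducible ϖ) (c : Sˣ)
    (hc : ϖ * c = s • ϖ)
    (h90 : ∀ x : S, ∏ g : G, g • x = 1 → ∃ y : S, y ≠ 0 ∧ s • y = x * y)
    (hres : ¬ IsAddCyclic (ResidueField S)) {m : ℕ} (hm : 1 ≤ m)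
    (hV : ∀ x : S, x - 1 ∈ maximalIdeal S ^ m → ∃ v : S, ∏ g : G, g • v = 1 ∧
      v - 1 ∈ maximalIdeal S ^ m ∧ x - v ∈ maximalIdeal S ^ (m + 1)) :
    ∃ x₁ : S, (∃ u : S, IsUnit u ∧ x₁ * u = s • u) ∧ x₁ - 1 ∈ maximalIdeal S ^ m ∧
      x₁ - 1 ∉ maximalIdeal S ^ (m + 1) := by
  classical
  by_contra hcon
  push Not at hcon
  -- the subgroups `𝒲 ≤ 𝒱` and `𝒰 k` of `Sˣ`
  let 𝒲 : Subgroup Sˣ :=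
    { carrier := {X | ∃ u : S, IsUnit u ∧ (X : S) * u = s • u}
      one_mem' := ⟨1, isUnit_one, by simp⟩
      mul_mem' := fun {X Y} hX hY => by
        simpa only [Set.mem_setOf_eq, Units.val_mul] using twist_mul s hX hY
      inv_mem' := fun {X} hX => twist_units_inv s hX }
  let 𝒱 : Subgroup Sˣ :=
    { carrier := {X | ∏ g : G, g • (X : S) = 1}
      one_mem' := by simp
      mul_mem' := fun {X Y} hX hY => by
        simp only [Set.mem_setOf_eq] at hX hY ⊢
        rw [Units.val_mul, prod_smul_mul, hX, hY, one_mul]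
      inv_mem' := fun {X} hX => by
        simp only [Set.mem_setOf_eq] at hX ⊢
        have h := prod_smul_mul (G := G) (X : S) ↑X⁻¹
        rw [Units.mul_inv, hX, one_mul] at h
        rw [← h]
        simp }
  let 𝒰 : ℕ → Subgroup Sˣ := fun k =>
    { carrier := {X | (X : S) - 1 ∈ maximalIdeal S ^ k}
      one_mem' := by simp
      mul_mem' := fun {X Y} hX hY => by
        simp only [Set.mem_setOf_eq] at hX hY ⊢
        rw [Units.val_mul]
        exact mul_sub_one_mem hX hY
      inv_mem' := fun {X} hX => units_inv_sub_one_mem hX }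
  have hWU : ∀ X : Sˣ, X ∈ 𝒲 → X ∈ 𝒰 m → X ∈ 𝒰 (m + 1) := fun X hX hXm => hcon X hX hXm
  -- the quotient by `𝒲`; the image of `𝒱` is generated by the class of `c`
  let π : Sˣ →* Sˣ ⧸ 𝒲 := QuotientGroup.mk' 𝒲
  have hπW : ∀ X : Sˣ, π X = 1 ↔ X ∈ 𝒲 := fun X => QuotientGroup.eq_one_iff X
  have hπV : ∀ X ∈ 𝒱, π X ∈ Subgroup.zpowers (π c) := by
    intro X hX
    obtain ⟨w, hw, j, hj⟩ := exists_twist_mul_pow s hϖ c hc h90 hX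
    obtain ⟨W', hW'⟩ := isUnit_of_twist s hw
    have hXeq : X = W' * c ^ j :=
      Units.ext (by rw [Units.val_mul, Units.val_pow_eq_pow_val, hW', ← hj])
    have hW'mem : W' ∈ 𝒲 := by
      show ∃ u : S, IsUnit u ∧ (W' : S) * u = s • u
      rw [hW']
      exact hw
    rw [hXeq, map_mul, map_pow]
    refine Subgroup.mul_mem _ ?_ (Subgroup.pow_mem _ (Subgroup.mem_zpowers _) j)
    rw [(hπW W').mpr hW'mem]
    exact Subgroup.one_mem _
  set H : Subgroup (Sˣ ⧸ 𝒲) := (𝒱 ⊓ 𝒰 m).map π with hH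
  have hHle : H ≤ Subgroup.zpowers (π c) := by
    rintro _ ⟨X, hX, rfl⟩
    exact hπV X hX.1
  haveI : IsCyclic H :=
    isCyclic_of_surjective (Subgroup.subgroupOfEquivOfLe hHle)
      (Subgroup.subgroupOfEquivOfLe hHle).surjective
  obtain ⟨h₀, hh₀⟩ := IsCyclic.exists_generator (α := H)
  obtain ⟨V₀, hV₀, hV₀eq⟩ : ∃ V₀ ∈ 𝒱 ⊓ 𝒰 m, π V₀ = h₀ := h₀.2
  -- every `V ∈ 𝒱 ∩ 𝒰 m` is `≡ V₀ᵏ` modulo `𝒰 (m+1)`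
  have hkey : ∀ V ∈ 𝒱 ⊓ 𝒰 m, ∃ k : ℤ, V * (V₀ ^ k)⁻¹ ∈ 𝒰 (m + 1) := by
    intro V hV
    have hmem : (⟨π V, Subgroup.mem_map_of_mem π hV⟩ : H) ∈ Subgroup.zpowers h₀ := hh₀ _
    obtain ⟨k, hk⟩ := Subgroup.mem_zpowers_iff.mp hmem
    have hk' : (π V₀) ^ k = π V := by
      have := congrArg Subtype.val hk
      rw [SubgroupClass.coe_zpow, ← hV₀eq] at this   -- careful: hV₀eq : π V₀ = ↑h₀
      exact this
    refine ⟨k, hWU _ ?_ ?_⟩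
    · rw [← hπW, map_mul, map_inv, map_zpow, hk', mul_inv_cancel]
    · exact (𝒰 m).mul_mem hV.2 ((𝒰 m).inv_mem ((𝒰 m).zpow_mem hV₀.2 k))
  -- residues: `V₀ - 1 = ϖᵐ a₀`, and every residue is an integer multiple of `ā₀`
  obtain ⟨a₀, ha₀⟩ : ϖ ^ m ∣ (V₀ : S) - 1 := by
    rw [← Ideal.mem_span_singleton, ← Ideal.span_singleton_pow, ← hϖ.maximalIdeal_eq]
    exact hV₀.2
  apply hres
  refine ⟨⟨IsLocalRing.residue S a₀, fun r => ?_⟩⟩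
  obtain ⟨a, rfl⟩ := IsLocalRing.residue_surjective r
  have hxm : (1 + ϖ ^ m * a) - 1 ∈ maximalIdeal S ^ m := by
    rw [add_sub_cancel_left, hϖ.maximalIdeal_eq, Ideal.span_singleton_pow]
    exact Ideal.mul_mem_right _ _ (Ideal.mem_span_singleton_self _)
  obtain ⟨v, hvN, hvm, hxv⟩ := hV (1 + ϖ ^ m * a) hxm
  obtain ⟨V, rfl⟩ := isUnit_of_sub_one_mem hm hvm
  obtain ⟨k, hk⟩ := hkey V ⟨hvN, hvm⟩
  have h1 : (V : S) - ((V₀ ^ k : Sˣ) : S) ∈ maximalIdeal S ^ (m + 1) := by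
    have : (V : S) - ((V₀ ^ k : Sˣ) : S) =
        (((V * (V₀ ^ k)⁻¹ : Sˣ) : S) - 1) * ((V₀ ^ k : Sˣ) : S) := by
      rw [sub_mul, one_mul, Units.val_mul, mul_assoc, Units.inv_mul, mul_one]
    rw [this]
    exact Ideal.mul_mem_right _ _ hk
  have h2 := units_zpow_sub_one_sub_mul_mem (I := maximalIdeal S) hm hV₀.2 k
  have h3 : ϖ ^ m * (a - k * a₀) ∈ maximalIdeal S ^ (m + 1) := by
    have : ϖ ^ m * (a - k * a₀) = (1 + ϖ ^ m * a - V) + ((V : S) - ((V₀ ^ k : Sˣ) : S)) +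
        ((((V₀ ^ k : Sˣ) : S)) - 1 - k * ((V₀ : S) - 1)) := by
      linear_combination (k : S) * ha₀
    rw [this]
    exact Ideal.add_mem _ (Ideal.add_mem _ hxv h1) h2
  have h4 : a - k * a₀ ∈ maximalIdeal S := by
    rw [hϖ.maximalIdeal_eq, Ideal.span_singleton_pow, Ideal.mem_span_singleton, pow_succ] at h3
    rw [hϖ.maximalIdeal_eq, Ideal.mem_span_singleton]
    exact (mul_dvd_mul_iff_left (pow_ne_zero m hϖ.ne_zero)).mp h3
  refine ⟨k, ?_⟩
  show k • IsLocalRing.residue S a₀ = IsLocalRing.residue S a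
  rw [← map_zsmul, zsmul_eq_mul]
  exact ((Ideal.Quotient.eq (I := maximalIdeal S)).mpr h4).symm

end Lemma12

end HasseArfCyclic

end Literature.NumberTheory.GaloisRepresentations

end
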